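import Literature.MathematicalPhysics.QuantumManyBody.PeriodicBoseGasScatteringODEProofs
import HarnessLib

/-!
# Differences of scattering lengths: the cross identity and FGJMOT Lemma 3.2

Topic `Literature/MathematicalPhysics/QuantumManyBody`, namespace `BoseGas` (provefact
`Literature.MathematicalPhysics.QuantumManyBody.BoseGas.Junge2026_neumannBox_pinnedLowerBound`;
first half of the scattering-length truncation of [FournaisEtAl2024, Prop. 2.1 / Lemma 3.3], on top
of the zero-energy radial ODE of `PeriodicBoseGasScatteringODEProofs.lean`). For two bounded
measurable radial potentials `w₁, w₂` of finite range (scattering equation `-Δφ + ½wφ = 0`, radial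
solutions `uᵢ`, profiles `fᵢ = uᵢ/(uᵢ'(R)r)`, scattering lengths `aᵢ = R - uᵢ(R)/uᵢ'(R)` read off at
`R` beyond both ranges), the printed integration by parts
"`4πa(v₁) - 4πa(v₂) = ⅛π⁻¹∫(v₁ - v₂)φ₁φ₂`" [FournaisEtAl2024, proof of Lemma 3.2] is, radially,
the tree's Wronskian identity `u₁'u₂ - u₁u₂' = ∫₀ʳ ½(W₁ - W₂)u₁u₂` (`wronskian_eq`) divided by
`u₁'(R)u₂'(R)`:

* `odeScatteringLength_sub_eq` — **the cross identity**
  `a₁ - a₂ = ∫₀ᴿ ½(W₁(s) - W₂(s)) s² f₁(s) f₂(s) ds`;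
* `odeScatteringLength_eq_of_le_of_le` — the read-off radius is immaterial beyond the range;
* `FournaisEtAl2024_lemma32` — **Lemma 3.2** for bounded measurable finite-range potentials:
  `v₂ ≤ v₁`, `v' ≥ 0` imply `a(v₁ + v') - a(v₂ + v') ≤ a(v₁) - a(v₂)` (the cross identity for both
  pairs, whose potential differences coincide, and the pointwise decrease of the profiles when the
  potential increases, `radialProfile_antitone_pot` [LSSY2005, Lemma C.2]).

No definitions.

## References

* [FournaisEtAl2024] S. Fournais, L. Junge, T. Girardot, L. Morin, M. Olivieri, A. Triay, *The free
  energy of dilute Bose gases at low temperatures interacting via strong potentials*,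
  arXiv:2408.14222, Ann. Henri Poincaré (2026): Lemma 3.2 and its proof.
* [LSSY2005] E. H. Lieb, R. Seiringer, J. P. Solovej, J. Yngvason, *The Mathematics of the Bose Gas
  and its Condensation*, Birkhäuser 2005: (2.4)–(2.5), App. C, Lemma C.2.
-/

noncomputable section

open MeasureTheory Set Filter Topology
open scoped ENNReal NNReal

namespace Literature.MathematicalPhysics.QuantumManyBody.BoseGas

section Cross

variable {w₁ w₂ : ℝ → ℝ≥0∞} {M R : ℝ}

/-- **The cross identity for scattering lengths**: for bounded measurable radial potentials and
`R ≥ 0`, `a₁ - a₂ = ∫₀ᴿ ½(W₁ - W₂)(s) s² f₁(s) f₂(s) ds` with `aᵢ = R - uᵢ(R)/uᵢ'(R)` and the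
profiles `fᵢ = uᵢ/(uᵢ'(R) r)` (the Wronskian identity at `R`, divided by `u₁'(R)u₂'(R)`).
[cite: FournaisEtAl2024, Lemma 3.2 (proof)] -/
theorem odeScatteringLength_sub_eq (hw₁ : Measurable w₁) (hw₂ : Measurable w₂)
    (hM₁ : ∀ r, w₁ r ≤ ENNReal.ofReal M) (hM₂ : ∀ r, w₂ r ≤ ENNReal.ofReal M) (hM0 : 0 ≤ M)
    (hR : 0 ≤ R) :
    odeScatteringLength w₁ R - odeScatteringLength w₂ R =
      ∫ s in Ioc 0 R, ((w₁ s).toReal - (w₂ s).toReal) / 2 *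
        (s ^ 2 * (radialProfile w₁ R s * radialProfile w₂ R s)) := by
  have hc₁ := slope_pos hw₁ hM₁ hM0 R
  have hc₂ := slope_pos hw₂ hM₂ hM0 R
  have hW := wronskian_eq hw₁ hw₂ hM₁ hM₂ hM0 hR
  -- rewrite the integrand of the Wronskian in profile form
  have hint : ∫ s in Ioc 0 R, ((w₁ s).toReal / 2 * radialSol w₁ s * radialSol w₂ s -
      radialSol w₁ s * ((w₂ s).toReal / 2 * radialSol w₂ s)) =
      (radialSolDeriv w₁ R * radialSolDeriv w₂ R) *
        ∫ s in Ioc 0 R, ((w₁ s).toReal - (w₂ s).toReal) / 2 *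
          (s ^ 2 * (radialProfile w₁ R s * radialProfile w₂ R s)) := by
    rw [← integral_const_mul]
    refine setIntegral_congr_fun measurableSet_Ioc fun s hs => ?_
    have hs0 : s ≠ 0 := hs.1.ne'
    rw [radialProfile_of_pos w₁ R hs.1, radialProfile_of_pos w₂ R hs.1]
    field_simp
  rw [hint] at hW
  have hode : odeScatteringLength w₁ R - odeScatteringLength w₂ R =
      (radialSolDeriv w₁ R * radialSol w₂ R - radialSol w₁ R * radialSolDeriv w₂ R) /
        (radialSolDeriv w₁ R * radialSolDeriv w₂ R) := by
    simp only [odeScatteringLength]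
    field_simp
    ring
  rw [hode, hW]
  field_simp

/-- **The read-off radius is immaterial beyond the range**: if `w = 0` on `(ρ, ∞)`, `0 ≤ ρ`, then
`R - u(R)/u'(R) = ρ - u(ρ)/u'(ρ)` for every `R ≥ ρ` (`u` is affine there). [cite: LSSY2005, (2.5)] -/
theorem odeScatteringLength_eq_of_le_of_le {w : ℝ → ℝ≥0∞} (hw : Measurable w)
    (hM : ∀ r, w r ≤ ENNReal.ofReal M) (hM0 : 0 ≤ M) {ρ : ℝ} (hρ : 0 ≤ ρ)
    (hwρ : ∀ s, ρ < s → w s = 0) (hρR : ρ ≤ R) :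
    odeScatteringLength w R = odeScatteringLength w ρ := by
  have hc := slope_pos hw hM hM0 ρ
  rw [odeScatteringLength, odeScatteringLength, radialSol_eq_of_ge hw hM hM0 hρ hwρ hρR,
    radialSolDeriv_eq_of_ge hw hM hM0 hρ hwρ hρR]
  field_simp
  ring

end Cross

/-! ### FGJMOT Lemma 3.2 -/

section Lemma32

variable {v₁ v₂ v' : ℝ → ℝ≥0∞} {M R : ℝ}

/-- The profile form of the cross integrand is integrable on `(0, R]`. [folklore] -/
theorem integrableOn_crossIntegrand {w₁ w₂ : ℝ → ℝ≥0∞} (hw₁ : Measurable w₁) (hw₂ : Measurable w₂)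
    (hM₁ : ∀ r, w₁ r ≤ ENNReal.ofReal M) (hM₂ : ∀ r, w₂ r ≤ ENNReal.ofReal M) (hM0 : 0 ≤ M)
    (hR : 0 < R) (hwR₁ : ∀ s, R < s → w₁ s = 0) (hwR₂ : ∀ s, R < s → w₂ s = 0)
    {g : ℝ → ℝ} (hg : Measurable g) (hgM : ∀ s, |g s| ≤ M) :
    IntegrableOn (fun s => g s / 2 * (s ^ 2 * (radialProfile w₁ R s * radialProfile w₂ R s)))
      (Ioc 0 R) := by
  refine integrableOn_Ioc_of_bound (C := M / 2 * (R ^ 2 * 1))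
    ((hg.div_const 2).mul ((measurable_id.pow_const 2).mul
      ((continuous_radialProfile hw₁ hM₁ hM0 hR hwR₁).measurable.mul
        (continuous_radialProfile hw₂ hM₂ hM0 hR hwR₂).measurable))) fun s hs => ?_
  have h1 := radialProfile_pos hw₁ hM₁ hM0 R s
  have h2 := radialProfile_pos hw₂ hM₂ hM0 R s
  have h1' := radialProfile_le_one hw₁ hM₁ hM0 hR hwR₁ s
  have h2' := radialProfile_le_one hw₂ hM₂ hM0 hR hwR₂ s
  rw [abs_mul, abs_div, abs_two, abs_mul, abs_of_nonneg (sq_nonneg s),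
    abs_of_nonneg (mul_nonneg h1.le h2.le)]
  have hs2 : s ^ 2 ≤ R ^ 2 := pow_le_pow_left₀ hs.1.le hs.2 2
  have hgs : |g s| / 2 ≤ M / 2 := by linarith [hgM s]
  have hff : radialProfile w₁ R s * radialProfile w₂ R s ≤ 1 := mul_le_one₀ h1' h2.le h2'
  exact mul_le_mul hgs (mul_le_mul hs2 hff (mul_nonneg h1.le h2.le) (sq_nonneg R))
    (by positivity) (by linarith)

/-- **FGJMOT Lemma 3.2** (for bounded measurable potentials of finite range): "for all
`v₁ ≥ v₂ ≥ 0` and `v' ≥ 0` we have `a(v₁) - a(v₂) ≥ a(v₁ + v') - a(v₂ + v')`" — here for radial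
profiles `v₁, v₂, v' ≤ M` vanishing beyond `R > 0`, with `a(·) = odeScatteringLength · R`
(`= scatteringLength` by LSSY Thm. C.1, `scatteringLength_eq_ofReal_odeScatteringLength`). Proof as
printed: by the cross identity both differences are `∫₀ᴿ ½(V₁ - V₂) s² f f̃ ds` with the profiles
of `v₁ + v', v₂ + v'`, resp. of `v₁, v₂`, and `0 < f_{vⱼ+v'} ≤ f_{vⱼ}` pointwise since the
potential increased [LSSY2005, Lemma C.2]. [cite: FournaisEtAl2024, Lemma 3.2] -/
theorem FournaisEtAl2024_lemma32 (hv₁ : Measurable v₁) (hv₂ : Measurable v₂) (hv' : Measurable v')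
    (hM₁ : ∀ r, v₁ r ≤ ENNReal.ofReal M) (hM₂ : ∀ r, v₂ r ≤ ENNReal.ofReal M)
    (hM' : ∀ r, v' r ≤ ENNReal.ofReal M) (hM0 : 0 ≤ M) (h21 : ∀ r, v₂ r ≤ v₁ r) (hR : 0 < R)
    (hR₁ : ∀ s, R < s → v₁ s = 0) (hR' : ∀ s, R < s → v' s = 0) :
    odeScatteringLength (v₁ + v') R - odeScatteringLength (v₂ + v') R ≤
      odeScatteringLength v₁ R - odeScatteringLength v₂ R := by
  -- bounds and ranges for the four potentials
  have hR₂ : ∀ s, R < s → v₂ s = 0 := fun s hs => le_zero_iff.mp ((h21 s).trans (hR₁ s hs).le)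
  have h2M : ∀ r, (v₁ + v') r ≤ ENNReal.ofReal (2 * M) := fun r => by
    rw [Pi.add_apply, two_mul, ENNReal.ofReal_add hM0 hM0]; exact add_le_add (hM₁ r) (hM' r)
  have h2M₂ : ∀ r, (v₂ + v') r ≤ ENNReal.ofReal (2 * M) := fun r => by
    rw [Pi.add_apply, two_mul, ENNReal.ofReal_add hM0 hM0]; exact add_le_add (hM₂ r) (hM' r)
  have hM₁' : ∀ r, v₁ r ≤ ENNReal.ofReal (2 * M) := fun r =>
    (hM₁ r).trans (ENNReal.ofReal_le_ofReal (by linarith))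
  have hM₂' : ∀ r, v₂ r ≤ ENNReal.ofReal (2 * M) := fun r =>
    (hM₂ r).trans (ENNReal.ofReal_le_ofReal (by linarith))
  have h2M0 : 0 ≤ 2 * M := by linarith
  have hRa : ∀ s, R < s → (v₁ + v') s = 0 := fun s hs => by simp [hR₁ s hs, hR' s hs]
  have hRb : ∀ s, R < s → (v₂ + v') s = 0 := fun s hs => by simp [hR₂ s hs, hR' s hs]
  have hma : Measurable (v₁ + v') := hv₁.add hv'
  have hmb : Measurable (v₂ + v') := hv₂.add hv'
  -- finiteness of the values, and the common potential difference
  have hfin : ∀ (u : ℝ → ℝ≥0∞), (∀ r, u r ≤ ENNReal.ofReal M) → ∀ r, u r ≠ ⊤ := fun u hu r =>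
    ne_top_of_le_ne_top ENNReal.ofReal_ne_top (hu r)
  have hdiff : ∀ s, ((v₁ + v') s).toReal - ((v₂ + v') s).toReal = (v₁ s).toReal - (v₂ s).toReal := by
    intro s
    rw [Pi.add_apply, Pi.add_apply, ENNReal.toReal_add (hfin v₁ hM₁ s) (hfin v' hM' s),
      ENNReal.toReal_add (hfin v₂ hM₂ s) (hfin v' hM' s)]
    ring
  have hgM : ∀ s, |(v₁ s).toReal - (v₂ s).toReal| ≤ M := by
    intro s
    have h1 : (v₁ s).toReal ≤ M := toReal_pot_le hM₁ hM0 s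
    have h2 : (v₂ s).toReal ≤ (v₁ s).toReal := ENNReal.toReal_mono (hfin v₁ hM₁ s) (h21 s)
    have h3 : 0 ≤ (v₂ s).toReal := ENNReal.toReal_nonneg
    rw [abs_of_nonneg (by linarith)]
    linarith
  have hgM2 : ∀ s, |(v₁ s).toReal - (v₂ s).toReal| ≤ 2 * M := fun s => (hgM s).trans (by linarith)
  have hgm : Measurable fun s => (v₁ s).toReal - (v₂ s).toReal :=
    hv₁.ennreal_toReal.sub hv₂.ennreal_toReal
  -- the two cross identities
  rw [odeScatteringLength_sub_eq hma hmb h2M h2M₂ h2M0 hR.le,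
    odeScatteringLength_sub_eq hv₁ hv₂ hM₁' hM₂' h2M0 hR.le]
  simp_rw [hdiff]
  refine setIntegral_mono_on
    (integrableOn_crossIntegrand hma hmb h2M h2M₂ h2M0 hR hRa hRb hgm hgM2)
    (integrableOn_crossIntegrand hv₁ hv₂ hM₁' hM₂' h2M0 hR hR₁ hR₂ hgm hgM2) measurableSet_Ioc
    fun s hs => ?_
  -- pointwise: `0 ≤ V₁ - V₂`, `0 < f_{v+v'} ≤ f_v`
  have hd0 : 0 ≤ ((v₁ s).toReal - (v₂ s).toReal) / 2 := by
    have := ENNReal.toReal_mono (hfin v₁ hM₁ s) (h21 s); linarith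
  have hfa := radialProfile_antitone_pot hv₁ hma hM₁' h2M h2M0 (fun r => le_self_add) hR hRa s
  have hfb := radialProfile_antitone_pot hv₂ hmb hM₂' h2M₂ h2M0 (fun r => le_self_add) hR hRb s
  have hpa := radialProfile_pos hma h2M h2M0 R s
  have hpb := radialProfile_pos hmb h2M₂ h2M0 R s
  have hs2 : 0 ≤ s ^ 2 := sq_nonneg s
  exact mul_le_mul_of_nonneg_left (mul_le_mul_of_nonneg_left
    (mul_le_mul hfa hfb hpb.le (hpa.le.trans hfa)) hs2) hd0

end Lemma32

end Literature.MathematicalPhysics.QuantumManyBody.BoseGas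

end
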